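import Mathlib.Data.Finset.Sym
import Mathlib.Data.Sym.Sym2
import Mathlib.Data.Finset.Card
import Mathlib.Data.Finset.Powerset
import Mathlib.Algebra.BigOperators.Group.Finset.Basic
import Mathlib.Algebra.Group.Nat.Even
import HarnessLib

/-!
# Perfect matchings of a finite vertex set, as edge sets

Support file for the discharge of `Literature.Barriers.PneNP.Rothvoss2017_tsp` (Rothvoß 2017:
"the perfect matching polytope ... is the convex hull of all characteristic vectors of perfect
matchings in a complete `n`-node graph", §1, PDF p. 4). Rothvoß's proof manipulates perfect
matchings of many vertex sets at once (blocks `A_i`, `B_i`, `C ∪ D` of a partition, their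
unions and differences), so we set them up over an arbitrary finite vertex SET `S : Finset V`
inside an ambient type:

* `IsPMOn S M` — `M : Finset (Sym2 V)` is a perfect matching of `S`: its edges are non-loop
  pairs inside `S` and every vertex of `S` lies on exactly one of them; `perfectMatchings S`,
  the `Finset` of all of them (decidable predicate).
* the local API (`mem_of_mem`, `unique`, `exists_mem`, `card_filter_eq`), and the structural
  operations the counting arguments use: `IsPMOn.union` (disjoint vertex sets),
  `IsPMOn.filter_sym2` / `IsPMOn.eq_union_filter` (a matching using no edge between two disjoint
  blocks splits into matchings of the blocks), `IsPMOn.sdiff` (removing a sub-matching leaves a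
  perfect matching of the remaining vertices), `IsPMOn.pair`, and existence on every vertex set
  of even size (`exists_isPMOn_of_even`).

All statements are elementary finite combinatorics. [folklore]
-/

namespace Literature.Barriers.PneNP

open Finset

variable {V : Type*} [DecidableEq V]

/-- `M` is (the edge set of) a **perfect matching of the vertex set `S`**: every edge of `M` is
a pair of two distinct elements of `S`, and every vertex of `S` lies on exactly one edge of `M`.
[cite: Rothvoss2017, §1 (PDF p. 4)] -/
def IsPMOn (S : Finset V) (M : Finset (Sym2 V)) : Prop :=
  M ⊆ S.sym2 ∧ (∀ e ∈ M, ¬e.IsDiag) ∧ ∀ v ∈ S, (M.filter fun e => v ∈ e).card = 1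

/-- `IsPMOn` is decidable (finite quantifiers over `Finset`s); no Mathlib instance is
duplicated, this is the instance for our own predicate. [folklore] -/
instance IsPMOn.instDecidable (S : Finset V) (M : Finset (Sym2 V)) : Decidable (IsPMOn S M) := by
  unfold IsPMOn
  infer_instance

/-- The finite set of all perfect matchings of `S`. [cite: Rothvoss2017, §1 (PDF p. 4)] -/
def perfectMatchings (S : Finset V) : Finset (Finset (Sym2 V)) :=
  S.sym2.powerset.filter fun M => IsPMOn S M

omit [DecidableEq V] in
/-- Membership in `perfectMatchings`. [folklore] -/
theorem mem_perfectMatchings [DecidableEq V] {S : Finset V} {M : Finset (Sym2 V)} :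
    M ∈ perfectMatchings S ↔ IsPMOn S M := by
  simp only [perfectMatchings, mem_filter, mem_powerset, and_iff_right_iff_imp]
  exact fun h => h.1

namespace IsPMOn

variable {S : Finset V} {M : Finset (Sym2 V)}

/-- Edges lie inside `S`. [folklore] -/
theorem subset_sym2 (h : IsPMOn S M) : M ⊆ S.sym2 := h.1

/-- Edges are not loops. [folklore] -/
theorem not_isDiag (h : IsPMOn S M) {e : Sym2 V} (he : e ∈ M) : ¬e.IsDiag := h.2.1 e he

/-- Endpoints of edges are vertices of `S`. [folklore] -/
theorem mem_of_mem (h : IsPMOn S M) {e : Sym2 V} (he : e ∈ M) {v : V} (hv : v ∈ e) : v ∈ S :=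
  mem_sym2_iff.1 (h.1 he) v hv

/-- Exactly one edge at each vertex of `S`. [folklore] -/
theorem card_filter (h : IsPMOn S M) {v : V} (hv : v ∈ S) :
    (M.filter fun e => v ∈ e).card = 1 :=
  h.2.2 v hv

/-- No edge at a vertex outside `S`. [folklore] -/
theorem filter_eq_empty (h : IsPMOn S M) {v : V} (hv : v ∉ S) :
    (M.filter fun e => v ∈ e) = ∅ :=
  filter_eq_empty_iff.2 fun _ he hve => hv (h.mem_of_mem he hve)

/-- The number of edges at `v` is `1` on `S` and `0` off `S`. [folklore] -/
theorem card_filter_eq (h : IsPMOn S M) (v : V) :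
    (M.filter fun e => v ∈ e).card = if v ∈ S then 1 else 0 := by
  split_ifs with hv
  · exact h.card_filter hv
  · rw [h.filter_eq_empty hv, card_empty]

/-- Every vertex of `S` is matched. [folklore] -/
theorem exists_mem (h : IsPMOn S M) {v : V} (hv : v ∈ S) : ∃ e ∈ M, v ∈ e := by
  obtain ⟨e, he⟩ := card_eq_one.1 (h.card_filter hv)
  have : e ∈ M.filter fun e => v ∈ e := by rw [he]; exact mem_singleton_self e
  exact ⟨e, (mem_filter.1 this).1, (mem_filter.1 this).2⟩

/-- Two edges of a perfect matching sharing a vertex are equal. [folklore] -/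
theorem unique (h : IsPMOn S M) {v : V} {e₁ e₂ : Sym2 V} (h₁ : e₁ ∈ M) (h₂ : e₂ ∈ M)
    (hv₁ : v ∈ e₁) (hv₂ : v ∈ e₂) : e₁ = e₂ := by
  have hv : v ∈ S := h.mem_of_mem h₁ hv₁
  obtain ⟨e, he⟩ := card_eq_one.1 (h.card_filter hv)
  have h1' : e₁ ∈ M.filter fun e => v ∈ e := mem_filter.2 ⟨h₁, hv₁⟩
  have h2' : e₂ ∈ M.filter fun e => v ∈ e := mem_filter.2 ⟨h₂, hv₂⟩
  rw [he, mem_singleton] at h1' h2'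
  rw [h1', h2']

/-- Edges at a vertex of `S` pin down the matching edge: if `e ∈ M` contains `v` then the set of
edges of `M` at `v` is `{e}`. [folklore] -/
theorem filter_eq_singleton (h : IsPMOn S M) {v : V} {e : Sym2 V} (he : e ∈ M) (hv : v ∈ e) :
    (M.filter fun e => v ∈ e) = {e} := by
  ext e'
  simp only [mem_filter, mem_singleton]
  exact ⟨fun h' => h.unique h'.1 he h'.2 hv, fun h' => h' ▸ ⟨he, hv⟩⟩

/-! ### Empty set, a single pair, disjoint unions -/

/-- The empty matching of the empty vertex set. [folklore] -/
theorem empty : IsPMOn (∅ : Finset V) ∅ :=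
  ⟨empty_subset _, by simp, by simp⟩

/-- The only perfect matching of `∅` is `∅`. [folklore] -/
theorem eq_empty (h : IsPMOn (∅ : Finset V) M) : M = ∅ := by
  have h0 : (∅ : Finset V).sym2 = ∅ := by simp
  exact subset_empty.1 (h0 ▸ h.1)

/-- A single edge is a perfect matching of its two (distinct) endpoints. [folklore] -/
theorem pair {a b : V} (hab : a ≠ b) : IsPMOn ({a, b} : Finset V) {s(a, b)} := by
  refine ⟨?_, ?_, ?_⟩
  · intro e he
    rw [mem_singleton] at he
    subst he
    rw [mk_mem_sym2_iff]
    simp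
  · intro e he
    rw [mem_singleton] at he
    subst he
    rwa [Sym2.mk_isDiag_iff]
  · intro v hv
    rw [card_eq_one]
    refine ⟨s(a, b), ?_⟩
    ext e
    simp only [mem_filter, mem_singleton]
    constructor
    · exact fun h => h.1
    · rintro rfl
      refine ⟨rfl, ?_⟩
      simp only [mem_insert, mem_singleton] at hv
      rcases hv with rfl | rfl <;> simp

/-- **Disjoint union**: perfect matchings of disjoint vertex sets combine. [folklore] -/
theorem union {S₁ S₂ : Finset V} {M₁ M₂ : Finset (Sym2 V)} (h₁ : IsPMOn S₁ M₁)
    (h₂ : IsPMOn S₂ M₂) (hd : Disjoint S₁ S₂) : IsPMOn (S₁ ∪ S₂) (M₁ ∪ M₂) := by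
  refine ⟨?_, ?_, ?_⟩
  · exact union_subset (h₁.1.trans (sym2_mono subset_union_left))
      (h₂.1.trans (sym2_mono subset_union_right))
  · intro e he
    rcases mem_union.1 he with he | he
    · exact h₁.not_isDiag he
    · exact h₂.not_isDiag he
  · intro v hv
    have hdisj : Disjoint (M₁.filter fun e => v ∈ e) (M₂.filter fun e => v ∈ e) := by
      rw [disjoint_left]
      intro e he₁ he₂
      have hv1 := h₁.mem_of_mem (mem_filter.1 he₁).1 (mem_filter.1 he₁).2
      have hv2 := h₂.mem_of_mem (mem_filter.1 he₂).1 (mem_filter.1 he₂).2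
      exact disjoint_left.1 hd hv1 hv2
    rw [filter_union, card_union_of_disjoint hdisj]
    rcases mem_union.1 hv with hv | hv
    · rw [h₁.card_filter hv, h₂.filter_eq_empty (disjoint_left.1 hd hv), card_empty]
    · rw [h₂.card_filter hv, h₁.filter_eq_empty (disjoint_right.1 hd hv), card_empty]

/-- The edges of two matchings of disjoint vertex sets are disjoint. [folklore] -/
theorem disjoint_of_disjoint {S₁ S₂ : Finset V} {M₁ M₂ : Finset (Sym2 V)} (h₁ : IsPMOn S₁ M₁)
    (h₂ : IsPMOn S₂ M₂) (hd : Disjoint S₁ S₂) : Disjoint M₁ M₂ := by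
  rw [disjoint_left]
  intro e he₁ he₂
  induction e using Sym2.ind with
  | h a b =>
    exact disjoint_left.1 hd (h₁.mem_of_mem he₁ (Sym2.mem_mk_left a b))
      (h₂.mem_of_mem he₂ (Sym2.mem_mk_left a b))

/-! ### Splitting along blocks -/

/-- **Splitting**: a perfect matching of `S₁ ∪ S₂` (disjoint) none of whose edges joins the two
blocks restricts to a perfect matching of `S₁`. [folklore] -/
theorem filter_sym2 {S₁ S₂ : Finset V} (h : IsPMOn (S₁ ∪ S₂) M) (hd : Disjoint S₁ S₂)
    (hresp : ∀ e ∈ M, e ∈ S₁.sym2 ∨ e ∈ S₂.sym2) :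
    IsPMOn S₁ (M.filter fun e => e ∈ S₁.sym2) := by
  refine ⟨fun e he => (mem_filter.1 he).2, fun e he => h.not_isDiag (mem_filter.1 he).1,
    fun v hv => ?_⟩
  rw [filter_filter]
  have : (M.filter fun e => e ∈ S₁.sym2 ∧ v ∈ e) = M.filter fun e => v ∈ e := by
    refine filter_congr fun e he => ⟨fun h' => h'.2, fun hve => ⟨?_, hve⟩⟩
    rcases hresp e he with h1 | h2
    · exact h1
    · exact absurd (mem_sym2_iff.1 h2 v hve) (disjoint_left.1 hd hv)
  rw [this, h.card_filter (mem_union_left _ hv)]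

/-- … and to a perfect matching of `S₂`. [folklore] -/
theorem filter_sym2_right {S₁ S₂ : Finset V} (h : IsPMOn (S₁ ∪ S₂) M) (hd : Disjoint S₁ S₂)
    (hresp : ∀ e ∈ M, e ∈ S₁.sym2 ∨ e ∈ S₂.sym2) :
    IsPMOn S₂ (M.filter fun e => e ∈ S₂.sym2) := by
  rw [union_comm] at h
  exact h.filter_sym2 hd.symm fun e he => (hresp e he).symm

omit [DecidableEq V] in
/-- … and the matching is the union of the two restrictions. [folklore] -/
theorem eq_union_filter [DecidableEq V] {S₁ S₂ : Finset V} {M : Finset (Sym2 V)}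
    (hresp : ∀ e ∈ M, e ∈ S₁.sym2 ∨ e ∈ S₂.sym2) :
    M = (M.filter fun e => e ∈ S₁.sym2) ∪ M.filter fun e => e ∈ S₂.sym2 := by
  ext e
  simp only [mem_union, mem_filter]
  constructor
  · intro he
    rcases hresp e he with h1 | h2
    · exact Or.inl ⟨he, h1⟩
    · exact Or.inr ⟨he, h2⟩
  · rintro (⟨he, -⟩ | ⟨he, -⟩) <;> exact he

/-- **Removing a sub-matching**: if a perfect matching `M` of `S₁ ∪ S₂` (disjoint) contains a
perfect matching `M₁` of `S₁`, then `M \ M₁` is a perfect matching of `S₂`. [folklore] -/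
theorem sdiff {S₁ S₂ : Finset V} (h : IsPMOn (S₁ ∪ S₂) M) (hd : Disjoint S₁ S₂)
    {M₁ : Finset (Sym2 V)} (h₁ : IsPMOn S₁ M₁) (hsub : M₁ ⊆ M) : IsPMOn S₂ (M \ M₁) := by
  have key : ∀ e ∈ M, e ∉ M₁ → e ∈ S₂.sym2 := by
    intro e he hne
    rw [mem_sym2_iff]
    intro a ha
    rcases mem_union.1 (h.mem_of_mem he ha) with ha1 | ha2
    · obtain ⟨e', he', hae'⟩ := h₁.exists_mem ha1
      have := h.unique he (hsub he') ha hae'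
      exact absurd (this ▸ he') hne
    · exact ha2
  refine ⟨fun e he => key e (mem_sdiff.1 he).1 (mem_sdiff.1 he).2,
    fun e he => h.not_isDiag (mem_sdiff.1 he).1, fun v hv => ?_⟩
  have : ((M \ M₁).filter fun e => v ∈ e) = M.filter fun e => v ∈ e := by
    ext e
    simp only [mem_filter, mem_sdiff]
    constructor
    · rintro ⟨⟨he, -⟩, hve⟩
      exact ⟨he, hve⟩
    · rintro ⟨he, hve⟩
      exact ⟨⟨he, fun he1 => disjoint_right.1 hd hv (h₁.mem_of_mem he1 hve)⟩, hve⟩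
  rw [this, h.card_filter (mem_union_right _ hv)]

/-- **Containing a sub-matching, characterised**: for disjoint `S₁, S₂` and a perfect matching
`M₁` of `S₁`, the perfect matchings of `S₁ ∪ S₂` containing `M₁` are exactly the `M₁ ∪ M₂`
with `M₂` a perfect matching of `S₂`. [folklore] -/
theorem superset_iff {S₁ S₂ : Finset V} (hd : Disjoint S₁ S₂) {M₁ : Finset (Sym2 V)}
    (h₁ : IsPMOn S₁ M₁) (M : Finset (Sym2 V)) :
    (IsPMOn (S₁ ∪ S₂) M ∧ M₁ ⊆ M) ↔ ∃ M₂, IsPMOn S₂ M₂ ∧ M = M₁ ∪ M₂ := by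
  constructor
  · rintro ⟨h, hsub⟩
    exact ⟨M \ M₁, h.sdiff hd h₁ hsub, (union_sdiff_of_subset hsub).symm⟩
  · rintro ⟨M₂, h₂, rfl⟩
    exact ⟨h₁.union h₂ hd, subset_union_left⟩

end IsPMOn

/-! ### Existence -/

/-- **Every vertex set of even size has a perfect matching.** [folklore] -/
theorem exists_isPMOn_of_even : ∀ (n : ℕ) (S : Finset V), S.card = n → Even n →
    ∃ M, IsPMOn S M := by
  intro n
  induction n using Nat.strong_induction_on with
  | _ n ih =>
    intro S hSn hn
    rcases S.eq_empty_or_nonempty with rfl | ⟨a, ha⟩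
    · exact ⟨∅, IsPMOn.empty⟩
    · have h2 : 2 ≤ S.card := by
        have h1 := card_pos.2 ⟨a, ha⟩
        obtain ⟨k, hk⟩ := hn
        omega
      obtain ⟨b, hb, hba⟩ : ∃ b ∈ S, b ≠ a := exists_mem_ne h2 a
      have hpair : ({a, b} : Finset V) ⊆ S := by
        intro x hx
        simp only [mem_insert, mem_singleton] at hx
        rcases hx with rfl | rfl
        · exact ha
        · exact hb
      have hcard : (S \ {a, b}).card = S.card - 2 := by
        rw [card_sdiff_of_subset hpair, card_pair hba.symm]
      have heven : Even (S \ {a, b}).card := by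
        rw [hcard, hSn]
        obtain ⟨k, hk⟩ := hn
        exact ⟨k - 1, by omega⟩
      obtain ⟨M', hM'⟩ := ih (S \ {a, b}).card (by rw [hcard]; omega) (S \ {a, b}) rfl heven
      refine ⟨{s(a, b)} ∪ M', ?_⟩
      have hS : S = {a, b} ∪ (S \ {a, b}) := (union_sdiff_of_subset hpair).symm
      rw [hS]
      exact (IsPMOn.pair hba.symm).union hM' disjoint_sdiff

/-- The set of perfect matchings of an even vertex set is nonempty. [folklore] -/
theorem perfectMatchings_nonempty {S : Finset V} (hS : Even S.card) :
    (perfectMatchings S).Nonempty := by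
  obtain ⟨M, hM⟩ := exists_isPMOn_of_even S.card S rfl hS
  exact ⟨M, mem_perfectMatchings.2 hM⟩

end Literature.Barriers.PneNP
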